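import Mathlib.Data.Setoid.Basic
import Mathlib.Data.Matrix.Mul
import Mathlib.Data.Real.Basic
import Mathlib.Data.Fintype.Powerset
import Mathlib.Data.Fintype.Sum
import Mathlib.Data.Fintype.Pi
import Mathlib.Algebra.BigOperators.Fin
import Mathlib.Algebra.BigOperators.Field
import Mathlib.LinearAlgebra.Matrix.ToLin
import Mathlib.Tactic.Positivity
import Mathlib.Tactic.Ring
import HarnessLib

/-!
# Row-to-row connectivity transfer matrices of bond percolation on `ℤ²` at `p = 1/2`

The "connectivity-state" (stochastic Temperley–Lieb, `β = 1`) transfer-matrix representation of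
planar bond percolation, as used for crossing probabilities of lattice polygons: Bondesan–Jacobsen–
Saleur, *Rectangular amplitudes, conformal blocks, and applications to loop models*, Nucl. Phys.
B 867 (2013) 913–949, arXiv:1207.7005, §2 (`BondesanJacobsenSaleur2012`); J. Cardy, *Conformal
invariance and percolation*, arXiv:math-ph/0103018, §7.1 (`Cardy2001`); Jacobsen–Zinn-Justin,
arXiv:cond-mat/0111374 (connectivity transfer matrices); Blöte–Nightingale 1982.
Requested by route `CriticalPhenomena/CardyPolygonWords` (items `JunctionOverlapLimit`,
`StepMapVertex`, `RowTransferExactness`, `GroundStateJunctions`).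

Everything is finite and elementary. For a finite set of columns `S ⊂ ℤ`:

* `RowPoint S = S ⊕ {⋆}` — the sites of the current row together with the symbol `⋆`
  ("joined to the bottom arc"); `RowState S` — connectivity patterns of the row: set partitions of
  `RowPoint S` (a one-field wrapper of `Setoid (RowPoint S)`; ALL partitions are allowed as index
  set — the patterns reachable from the wired state are the planar/non-crossing ones, a fact not
  needed for the definitions); it is a finite type (`RowState.instFintype`).
* The EDGE-BY-EDGE Markov step (the convenient form for exactness proofs): `vertRel O π` — add a
  new row above the old one, the vertical edge below the new site `x` being open iff `x ∈ O`
  (new `x`, `y` are joined iff both their vertical edges are open and the old `x`, `y` were joined;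
  new `x` is joined to `⋆` iff its vertical edge is open and old `x` was; closed sites become
  singletons; classes of the old row not reaching the new row are forgotten, `⋆` is kept);
  `horizRel H π` — open the horizontal edges `{x, x+1}`, `x ∈ H`, inside the row (join the classes);
  `rowStep O H = horizRel H ∘ vertRel O`.
* `PercolationRowTransfer S : Matrix (RowState S) (RowState S) ℝ` — **the stochastic row-to-row
  transfer matrix at `p = 1/2` with free side walls**: `T π π' = ℙ(rowStep O H π = π')` for `O` a
  uniformly random subset of `S` (i.i.d. Bernoulli(1/2) vertical edges) and `H` a uniformly random
  subset of the horizontal edges `hEdges S = {x ∈ S : x + 1 ∈ S}`; distributions are ROW vectors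
  (`μ ↦ μ ᵥ* T`), observables column vectors (`f ↦ T *ᵥ f`). `sum_percolationRowTransfer_eq_one`:
  every row sums to `1` (stochastic — no cemetery is needed because `⋆` is never deleted; a pattern
  in which no site is joined to `⋆` simply stays such).
* `rowBoundary S` (the vector `α_S`: Dirac mass at the fully wired pattern, bottom row wired to the
  bottom arc) and `rowReadout S` (the functional `β_S`: indicator that some site of the row is
  joined to `⋆`).
* Junctions for `S ⊆ S'`: `insertState` (new columns as singletons) and `restrictState` (forget
  columns, keep the induced partition including `⋆`, Mathlib `Setoid.comap`), with
  `restrictState_insertState`; their linear actions on distributions `junctionInsert`,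
  `junctionRestrict` are instances of `statePushforward` (mass-preserving, `sum_statePushforward`).

Remark (not formalised): on planar link patterns `T_S` is the product over the row of the
Temperley–Lieb(`β = 1`) generators `(1 + eᵢ)/2` — the double-row transfer matrix of the loop model
at the isotropic percolation point (Blöte–Nightingale 1982; BJS §2).
-/

noncomputable section

open Finset Matrix
open scoped BigOperators Classical

namespace Literature.Probability.LatticeModels

/-! ### Row sites, `⋆`, and connectivity states -/

/-- The points of a row over the column set `S`, together with the extra symbol `⋆` (`Sum.inr ()`,
"joined to the bottom arc"). [cite: BondesanJacobsenSaleur2012, §2] -/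
abbrev RowPoint (S : Finset ℤ) : Type := (S : Type) ⊕ Unit

/-- The symbol `⋆` ("the class of the bottom arc"). [cite: BondesanJacobsenSaleur2012, §2] -/
def RowPoint.star (S : Finset ℤ) : RowPoint S := Sum.inr ()

/-- A **row connectivity state**: a set partition of the row sites and `⋆` (which sites are
joined to each other / to the bottom arc by open paths below the row). One-field wrapper of
`Setoid (RowPoint S)`. [cite: BondesanJacobsenSaleur2012, §2 (connectivity states)] -/
@[ext]
structure RowState (S : Finset ℤ) where
  /-- The underlying equivalence relation "is joined to". -/
  rel : Setoid (RowPoint S)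

namespace RowState

variable {S : Finset ℤ}

/-- Connectivity states form a finite set (partitions of a finite set). [folklore] -/
instance instFinite : Finite (RowState S) := by
  refine Finite.of_injective (fun π : RowState S => fun a b : RowPoint S => π.rel a b) ?_
  intro π ρ h
  ext a b
  exact iff_of_eq (congrFun (congrFun h a) b)

/-- Connectivity states form a `Fintype` (noncomputably). [folklore] -/
instance instFintype : Fintype (RowState S) := Fintype.ofFinite _

/-- The fully wired state: all sites joined to each other and to `⋆`. [cite: BondesanJacobsenSaleur2012, §2] -/
def wired (S : Finset ℤ) : RowState S := ⟨⊤⟩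

/-- The totally disconnected state: all classes are singletons. [folklore] -/
def free (S : Finset ℤ) : RowState S := ⟨⊥⟩

/-- The site `x` is joined to the bottom arc in the state `π`. [cite: BondesanJacobsenSaleur2012, §2] -/
def JoinedToStar (π : RowState S) (x : S) : Prop := π.rel (Sum.inl x) (RowPoint.star S)

/-- The wired state inhabits `RowState S`. [folklore] -/
instance : Inhabited (RowState S) := ⟨wired S⟩

end RowState

/-! ### The edge-by-edge Markov step -/

section Step

variable {S : Finset ℤ}

/-- A row point is *open towards the new row* for the vertical-edge configuration `O ⊆ S`: the
site `x` iff its vertical edge is open (`x ∈ O`); `⋆` always (it is carried along).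
[cite: BondesanJacobsenSaleur2012, §2] -/
def IsUp (O : Finset S) : RowPoint S → Prop
  | Sum.inl x => x ∈ O
  | Sum.inr _ => True

/-- **Vertical layer.** After adding a row whose open vertical edges are those below the sites of
`O`, two row points are joined iff they are equal, or both are open towards the new row and were
joined in the old row. [cite: BondesanJacobsenSaleur2012, §2] -/
def vertRel (O : Finset S) (π : Setoid (RowPoint S)) : Setoid (RowPoint S) where
  r a b := a = b ∨ (IsUp O a ∧ IsUp O b ∧ π a b)
  iseqv :=
    { refl := fun _ => Or.inl rfl
      symm := by
        rintro a b (rfl | ⟨ha, hb, hab⟩)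
        · exact Or.inl rfl
        · exact Or.inr ⟨hb, ha, π.symm hab⟩
      trans := by
        rintro a b c (rfl | ⟨ha, hb, hab⟩) (rfl | ⟨hb', hc, hbc⟩)
        · exact Or.inl rfl
        · exact Or.inr ⟨hb', hc, hbc⟩
        · exact Or.inr ⟨ha, hb, hab⟩
        · exact Or.inr ⟨ha, hc, π.trans hab hbc⟩ }

/-- Unfolding lemma for `vertRel`. [folklore] -/
theorem vertRel_apply (O : Finset S) (π : Setoid (RowPoint S)) (a b : RowPoint S) :
    vertRel O π a b ↔ a = b ∨ (IsUp O a ∧ IsUp O b ∧ π a b) :=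
  Iff.rfl

/-- The horizontal edges inside the row: `x ∈ S` with `x + 1 ∈ S` labels the edge `{x, x+1}`.
[cite: BondesanJacobsenSaleur2012, §2] -/
def hEdges (S : Finset ℤ) : Finset S :=
  univ.filter fun x : S => (x : ℤ) + 1 ∈ S

/-- The partition joining exactly the two row points `a` and `b` (kernel of the map collapsing `b`
onto `a`). [folklore] -/
def joinTwo (a b : RowPoint S) : Setoid (RowPoint S) :=
  Setoid.ker fun c => if c = b then a else c

/-- The partition generated by the open horizontal edge at `x` (joining `x` and `x + 1` when
`x + 1 ∈ S`; trivial otherwise). [cite: BondesanJacobsenSaleur2012, §2] -/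
def hEdgeRel (x : S) : Setoid (RowPoint S) :=
  if h : (x : ℤ) + 1 ∈ S then joinTwo (Sum.inl x) (Sum.inl ⟨(x : ℤ) + 1, h⟩) else ⊥

/-- **Horizontal layer.** Open the horizontal edges labelled by `H`: join, in the lattice of
partitions, with the partitions generated by these edges. [cite: BondesanJacobsenSaleur2012, §2] -/
def horizRel (H : Finset S) (π : Setoid (RowPoint S)) : Setoid (RowPoint S) :=
  π ⊔ H.sup hEdgeRel

/-- Opening edges only joins classes: `π ≤ horizRel H π`. [folklore] -/
theorem le_horizRel (H : Finset S) (π : Setoid (RowPoint S)) : π ≤ horizRel H π :=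
  le_sup_left

/-- **One row of bond percolation, given the randomness**: vertical edges below the sites of `O`
open, then horizontal edges labelled by `H` open. [cite: BondesanJacobsenSaleur2012, §2] -/
def rowStep (O H : Finset S) (π : RowState S) : RowState S :=
  ⟨horizRel H (vertRel O π.rel)⟩

end Step

/-! ### The stochastic transfer matrix at `p = 1/2` -/

/-- **The row-to-row transfer matrix of bond percolation on `ℤ²` at `p = 1/2` with free side
walls** on the columns `S`: `T π π'` is the probability that one row step from the pattern `π`
produces `π'`, the vertical edges being i.i.d. Bernoulli(1/2) (a uniformly random `O ⊆ S`) and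
the horizontal edges i.i.d. Bernoulli(1/2) (a uniformly random `H ⊆ hEdges S`). Distributions act
as row vectors (`μ ᵥ* T`). The stochastic Temperley–Lieb (`β = 1`) representation of
Bondesan–Jacobsen–Saleur §2 / Cardy §7.1. [cite: BondesanJacobsenSaleur2012, §2] -/
def PercolationRowTransfer (S : Finset ℤ) : Matrix (RowState S) (RowState S) ℝ :=
  fun π π' =>
    (((univ : Finset (Finset S)) ×ˢ (hEdges S).powerset).filter
        (fun OH => rowStep OH.1 OH.2 π = π')).card /
      ((2 : ℝ) ^ S.card * 2 ^ (hEdges S).card)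

/-- Entries of the transfer matrix are nonnegative. [folklore] -/
theorem percolationRowTransfer_nonneg (S : Finset ℤ) (π π' : RowState S) :
    0 ≤ PercolationRowTransfer S π π' := by
  unfold PercolationRowTransfer
  positivity

/-- The number of edge configurations of one row step: `2^|S|` vertical times `2^|hEdges S|`
horizontal. [folklore] -/
theorem card_univ_product_powerset (S : Finset ℤ) :
    (((univ : Finset (Finset S)) ×ˢ (hEdges S).powerset).card : ℝ) =
      (2 : ℝ) ^ S.card * 2 ^ (hEdges S).card := by
  rw [card_product, card_powerset, card_univ, Fintype.card_finset, Fintype.card_coe]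
  push_cast
  ring

/-- **The transfer matrix is stochastic**: each row sums to `1` (every edge configuration produces
exactly one new pattern). [cite: BondesanJacobsenSaleur2012, §2] -/
theorem sum_percolationRowTransfer_eq_one (S : Finset ℤ) (π : RowState S) :
    ∑ π', PercolationRowTransfer S π π' = 1 := by
  unfold PercolationRowTransfer
  rw [← Finset.sum_div]
  have hpos : (0 : ℝ) < (2 : ℝ) ^ S.card * 2 ^ (hEdges S).card := by positivity
  rw [div_eq_one_iff_eq hpos.ne', ← card_univ_product_powerset]
  rw [← Nat.cast_sum, Nat.cast_inj]
  symm
  exact card_eq_sum_card_fiberwise fun OH _ => mem_univ (rowStep OH.1 OH.2 π)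

/-! ### Boundary vector and read-out functional -/

/-- **The boundary vector `α_S`**: the Dirac mass at the fully wired pattern (the bottom row of the
polygon is wired to the bottom marked arc). [cite: Cardy2001, §7.1] -/
def rowBoundary (S : Finset ℤ) : RowState S → ℝ :=
  fun π => if π = RowState.wired S then 1 else 0

/-- **The read-out functional `β_S`**: indicator that some site of the row is joined to `⋆`
(an open path from the bottom arc reaches the row). [cite: Cardy2001, §7.1] -/
def rowReadout (S : Finset ℤ) : RowState S → ℝ :=
  fun π => if ∃ x : S, π.JoinedToStar x then 1 else 0

/-- `α_S` is a probability vector. [folklore] -/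
theorem sum_rowBoundary (S : Finset ℤ) : ∑ π, rowBoundary S π = 1 := by
  simp [rowBoundary, Finset.sum_ite_eq']

/-- `0 ≤ β_S ≤ 1`. [folklore] -/
theorem rowReadout_mem_Icc (S : Finset ℤ) (π : RowState S) : rowReadout S π ∈ Set.Icc (0 : ℝ) 1 := by
  unfold rowReadout
  split_ifs <;> norm_num

/-! ### Junctions: changing the column set -/

section Junction

variable {S S' : Finset ℤ}

/-- The inclusion of row points along `S ⊆ S'` (`⋆ ↦ ⋆`). [folklore] -/
def RowPoint.incl (h : S ⊆ S') : RowPoint S → RowPoint S'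
  | Sum.inl x => Sum.inl ⟨x, h x.2⟩
  | Sum.inr u => Sum.inr u

/-- `RowPoint.incl` is injective. [folklore] -/
theorem RowPoint.incl_injective (h : S ⊆ S') : Function.Injective (RowPoint.incl h) := by
  rintro (x | u) (y | v) hxy
  · simp only [RowPoint.incl, Sum.inl.injEq, Subtype.mk.injEq] at hxy
    exact congrArg Sum.inl (Subtype.ext hxy)
  · simp [RowPoint.incl] at hxy
  · simp [RowPoint.incl] at hxy
  · cases u; cases v; rfl

/-- **Insertion `J_{S,S'}`** (`S ⊆ S'`): the new columns become singletons, the old pattern is kept.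
[cite: BondesanJacobsenSaleur2012, §2 (junctions)] -/
def insertRel (h : S ⊆ S') (π : Setoid (RowPoint S)) : Setoid (RowPoint S') where
  r a b := a = b ∨ ∃ a' b', RowPoint.incl h a' = a ∧ RowPoint.incl h b' = b ∧ π a' b'
  iseqv :=
    { refl := fun _ => Or.inl rfl
      symm := by
        rintro a b (rfl | ⟨a', b', rfl, rfl, hab⟩)
        · exact Or.inl rfl
        · exact Or.inr ⟨b', a', rfl, rfl, π.symm hab⟩
      trans := by
        rintro a b c (rfl | ⟨a', b', rfl, rfl, hab⟩) (h2 | ⟨b'', c', hb, rfl, hbc⟩)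
        · exact Or.inl h2
        · exact Or.inr ⟨b'', c', hb, rfl, hbc⟩
        · subst h2
          exact Or.inr ⟨a', b', rfl, rfl, hab⟩
        · obtain rfl := RowPoint.incl_injective h hb
          exact Or.inr ⟨a', c', rfl, rfl, π.trans hab hbc⟩ }

/-- **Restriction `J_{S',S}`** (`S ⊆ S'`): forget the columns outside `S`, keeping the induced
partition (including the class of `⋆`) — Mathlib's `Setoid.comap` along the inclusion.
[cite: BondesanJacobsenSaleur2012, §2 (junctions)] -/
def restrictRel (h : S ⊆ S') (π' : Setoid (RowPoint S')) : Setoid (RowPoint S) :=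
  π'.comap (RowPoint.incl h)

/-- Insertion of states. [cite: BondesanJacobsenSaleur2012, §2] -/
def insertState (h : S ⊆ S') (π : RowState S) : RowState S' := ⟨insertRel h π.rel⟩

/-- Restriction of states. [cite: BondesanJacobsenSaleur2012, §2] -/
def restrictState (h : S ⊆ S') (π' : RowState S') : RowState S := ⟨restrictRel h π'.rel⟩

/-- Restricting an inserted pattern gives it back. [folklore] -/
theorem restrictState_insertState (h : S ⊆ S') (π : RowState S) :
    restrictState h (insertState h π) = π := by
  ext a b
  change (insertRel h π.rel) (RowPoint.incl h a) (RowPoint.incl h b) ↔ π.rel a b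
  constructor
  · rintro (hab | ⟨a', b', ha, hb, hab⟩)
    · rw [RowPoint.incl_injective h hab]
    · obtain rfl := RowPoint.incl_injective h ha
      obtain rfl := RowPoint.incl_injective h hb
      exact hab
  · intro hab
    exact Or.inr ⟨a, b, rfl, rfl, hab⟩

end Junction

/-! ### Linear actions on distributions -/

section Linear

variable {ι κ : Type*} [Fintype ι] [Fintype κ]

/-- Push-forward of a (signed) distribution on a finite state space along a map of states, as a
linear map. [folklore] -/
def statePushforward (f : ι → κ) : (ι → ℝ) →ₗ[ℝ] (κ → ℝ) where
  toFun μ := fun k => ∑ i ∈ univ.filter (fun i => f i = k), μ i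
  map_add' μ ν := by
    funext k
    simp [Finset.sum_add_distrib]
  map_smul' c μ := by
    funext k
    simp [Finset.mul_sum]

/-- Push-forward preserves the total mass. [folklore] -/
theorem sum_statePushforward (f : ι → κ) (μ : ι → ℝ) : ∑ k, statePushforward f μ k = ∑ i, μ i := by
  simp only [statePushforward, LinearMap.coe_mk, AddHom.coe_mk]
  exact (Finset.sum_fiberwise_of_maps_to (fun i _ => mem_univ (f i)) μ)

variable {S S' : Finset ℤ}

/-- **The junction letter `J_{S,S'}`** on distributions (`S ⊆ S'`). [cite: BondesanJacobsenSaleur2012, §2] -/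
def junctionInsert (h : S ⊆ S') : (RowState S → ℝ) →ₗ[ℝ] (RowState S' → ℝ) :=
  statePushforward (insertState h)

/-- **The junction letter `J_{S',S}`** on distributions (`S ⊆ S'`). [cite: BondesanJacobsenSaleur2012, §2] -/
def junctionRestrict (h : S ⊆ S') : (RowState S' → ℝ) →ₗ[ℝ] (RowState S → ℝ) :=
  statePushforward (restrictState h)

/-- The transfer matrix as a linear map on distributions (row vectors): `μ ↦ μ ᵥ* T`.
[cite: BondesanJacobsenSaleur2012, §2] -/
def transferLin (S : Finset ℤ) : (RowState S → ℝ) →ₗ[ℝ] (RowState S → ℝ) :=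
  (PercolationRowTransfer S).vecMulLinear

/-- The transfer step preserves the total mass of a distribution (stochasticity).
[cite: BondesanJacobsenSaleur2012, §2] -/
theorem sum_transferLin (S : Finset ℤ) (μ : RowState S → ℝ) :
    ∑ π', transferLin S μ π' = ∑ π, μ π := by
  simp only [transferLin, Matrix.vecMulLinear_apply, Matrix.vecMul, dotProduct]
  rw [Finset.sum_comm]
  refine Finset.sum_congr rfl fun π _ => ?_
  rw [← Finset.mul_sum, sum_percolationRowTransfer_eq_one, mul_one]

end Linear

end Literature.Probability.LatticeModels

end
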